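import Literature.NumberTheory.EllipticCurves.KubertTateFiveMuDescentNumberFieldValuation
import Literature.NumberTheory.NumberFields.CyclotomicFieldFourValuations
import HarnessLib

/-!
# The `5`-descent on `E_{m,n}` over a number field `K`, III: the Kummer homomorphism on `K`-points and the
# box-filling criterion `5 ^ k ≤ #(E(K)/5E(K))` from `k` points and a determinant mod `5` at `k` places

PROOF-ONLY file (theorems only, no definition, no named fact, no `sorry`), topic `NumberTheory/EllipticCurves`;
sequel of `KubertTateFiveMuDescentNumberField[Valuation]`, the base-field-generic form of §§1–4 of the tree's
`KubertTateFiveMuDescentBox` (`K = ℚ`, valuations `padicValRat`).  Setting: `E = E_{m,n}` over a number field `K`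
(`m, n ∈ ℤ`), `φ` Vélu's `5`-isogeny, `ψ` a dual, `T = (0,0)`, a `Γ_K`-fixed `P₁` with `25 P₁ ≠ O`,
`f_T = xy − nx² + n²y`; the valuation at a finite place `v` of `K` is read as `log (v.valuation K ·) ∈ ℤ`
(Mathlib's normalisation, `= -ord_v`).

* `kummerValue_ne_zero` — `f_T(x, y) ≠ 0` at a `K`-rational affine point `(x, y) ≠ T` (read in `K_v` at a place
  `v ∤ mn`, tree `valued_kummerFn_eq_pow`).
* `exists_kummerHom` — the Kummer homomorphism `κ : E(K) → H¹(K, E'[ψ])`, `P ↦ [σ ↦ σQ − Q]` (`ψ Q = P`), killing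
  `5E(K)`.
* `exists_valHom` — for finite places `v₀, …, v_{k−1}` of `K`, **the valuation homomorphism
  `Φ : E(K) → (ℤ/5)^k`**, `Φ(P)_j = log v_j(a) mod 5` for a representative `a ∈ Kˣ` of the Kummer invariant of
  `κ(P)`; `Φ(5R) = 0` and, for `K`-rational affine `P, P' ≠ T`, **`Φ(P) − Φ(P') = (log v_j f_T(P) − log v_j f_T(P'))_j`**
  (the descent identity `a·u⁵·f_T(5P₁) = f_T(P)`, tree `IsogenyDualKernelKummerDescent.exists_mul_pow_eq_value_of_coboundary`).
* **`pow_le_natCard_quotient_of_matrix`** — if `k` affine `K`-points `P_i ≠ T` and a base point `P' ≠ T` have a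
  valuation matrix `M_{ij} = log v_j f_T(P_i) − log v_j f_T(P') (mod 5)` with `c ↦ cM` onto `(ℤ/5)^k`, then
  `5 ^ k ≤ #(E(K)/5E(K))` — for ANY `k` places (no support condition).

The Gaussian sequel `KubertTateFiveMuDescentGaussianMatrix` turns a full box over `ℚ(i)` into `t₅ = 0` and the rank.
With split primes `ℓ ≡ 1 (mod 4)` dividing `mn` the two places above `ℓ` are separate columns; points of `E(ℚ(i))`
coming from the quadratic twist `E^{(-1)}(ℚ)` have different valuations there, which is how the box detects
`rank E^{(-1)}(ℚ) > 0` (transfer statement T, stmt-22356; BSD is not proved by this).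

## References

* [SilvermanAEC2009] J. H. Silverman, *AEC*, 2nd ed., X.§4 Prop. 4.1, Thm. X.4.2, Prop. X.4.9, Exercise 10.1(c),
  Thm. X.1.1, Thm. VIII.6.7.
* [Fisher2001FiveSevenDescent] T. Fisher, JEMS 3 (2001), §§1–2.
-/

noncomputable section

open scoped Classical NNReal NumberField AddSubgroup
open WeierstrassCurve WeierstrassCurve.Isogeny Field IsDedekindDomain
open Literature.NumberTheory.EllipticCurves Literature.NumberTheory.EllipticCurves.KubertTateKummer
  Literature.NumberTheory.EllipticCurves.KubertTateVelu Literature.NumberTheory.GaloisRepresentations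
  Literature.NumberTheory.NumberFields

namespace Literature.NumberTheory.EllipticCurves

namespace KubertTateMuDescentNF

variable {K : Type} [Field K] [NumberField K]
variable (m n : ℤ) [hE : (kubertTateFive (m : K) (n : K)).IsElliptic]
variable (ψ : Isogeny (kubertTateFive' (m : K) (n : K)) (kubertTateFive (m : K) (n : K)))
  (hψ : ∀ P, ψ (fiveIsogeny (m : K) (n : K) P) = ((5 : ℕ) : ℤ) • P)
variable (P₁ : geomPoints (kubertTateFive (m : K) (n : K)))
  (hP₁ : ∀ σ : absoluteGaloisGroup K, σ • P₁ = P₁) (h25 : ((25 : ℕ) : ℤ) • P₁ ≠ 0)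

/-! ## §1 Values of `f_T` at `K`-rational points are non-zero -/

omit hE in
/-- Every rational prime lies under some finite place of `K`. [folklore] -/
private theorem exists_natCast_mem_asIdeal {ℓ : ℕ} (hℓ : ℓ.Prime) :
    ∃ v : HeightOneSpectrum (𝓞 K), (ℓ : 𝓞 K) ∈ v.asIdeal := by
  haveI := Fact.mk hℓ
  obtain ⟨⟨P, hP, hPover⟩⟩ := (Ideal.span {(ℓ : ℤ)}).nonempty_primesOver (S := 𝓞 K)
  have hℓZ : (ℓ : ℤ) ≠ 0 := Int.natCast_ne_zero.mpr hℓ.ne_zero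
  have hP0 : P ≠ ⊥ := Ideal.ne_bot_of_liesOver_of_ne_bot (p := Ideal.span {(ℓ : ℤ)}) (by simpa using hℓZ) P
  refine ⟨⟨P, hP, hP0⟩, ?_⟩
  have h : ((ℓ : ℤ) : ℤ) ∈ Ideal.span {(ℓ : ℤ)} := Ideal.mem_span_singleton_self _
  rw [Ideal.mem_of_liesOver P] at h
  simpa using h

omit hE in
/-- A place `v ∤ mn`: above a rational prime `q > |m| + |n|`. [folklore] -/
private theorem exists_place_off (hm : m ≠ 0) (hn : n ≠ 0) :
    ∃ v : HeightOneSpectrum (𝓞 K), ((m : ℤ) : 𝓞 K) ∉ v.asIdeal ∧ ((n : ℤ) : 𝓞 K) ∉ v.asIdeal := by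
  obtain ⟨q, hqgt, hq⟩ := Nat.exists_infinite_primes (m.natAbs + n.natAbs + 1)
  obtain ⟨v, hv⟩ := exists_natCast_mem_asIdeal (K := K) hq
  have key : ∀ z : ℤ, z ≠ 0 → z.natAbs < q → ((z : ℤ) : 𝓞 K) ∉ v.asIdeal := by
    intro z hz hlt hmem
    have hdvd := natCast_dvd_of_intCast_mem hq hv hmem
    have : q ≤ z.natAbs := Nat.le_of_dvd (Int.natAbs_pos.mpr hz) (by
      have := Int.natAbs_dvd_natAbs.mpr hdvd; simpa using this)
    omega
  exact ⟨v, key m hm (by omega), key n hn (by omega)⟩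

/-- **`f_T(x, y) = xy − nx² + n²y ≠ 0` at a `K`-rational affine point `(x, y) ≠ T` of `E_{m,n}`** (read in `K_v` for
a place `v ∤ mn`, where `v(f_T) ∈ 5ℤ`, tree `valued_kummerFn_eq_pow`). [cite: SilvermanAEC2009, Exercise 10.1(c)] -/
theorem kummerValue_ne_zero {x y : K}
    (he : y ^ 2 + ((n : K) - m) * x * y - m * (n : K) ^ 2 * y = x ^ 3 - m * n * x ^ 2) (hT : ¬ (x = 0 ∧ y = 0)) :
    x * y - n * x ^ 2 + (n : K) ^ 2 * y ≠ 0 := by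
  obtain ⟨hm0, hn0, -⟩ := ne_zero_of_isElliptic (m : K) (n : K)
  have hm : m ≠ 0 := by exact_mod_cast hm0
  have hn : n ≠ 0 := by exact_mod_cast hn0
  obtain ⟨v, hvm, hvn⟩ := exists_place_off (K := K) m n hm hn
  set L := v.adicCompletion K
  have he' : (algebraMap K L y) ^ 2 + ((n : L) - m) * algebraMap K L x * algebraMap K L y -
      m * (n : L) ^ 2 * algebraMap K L y = (algebraMap K L x) ^ 3 - m * n * (algebraMap K L x) ^ 2 := by
    have := congrArg (algebraMap K L) he
    simpa [map_sub, map_add, map_mul, map_pow, map_intCast] using this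
  have hT' : ¬ (algebraMap K L x = 0 ∧ algebraMap K L y = 0) := by
    rintro ⟨hx, hy⟩
    exact hT ⟨(map_eq_zero _).mp hx, (map_eq_zero _).mp hy⟩
  obtain ⟨hF0, -⟩ := valued_kummerFn_eq_pow m n v hvm hvn he' hT'
  intro h0
  apply hF0
  have := congrArg (algebraMap K L) h0
  simpa [map_sub, map_add, map_mul, map_pow, map_intCast] using this

/-! ## §2 The Kummer homomorphism on `K`-points and its valuation vector -/

omit hE in
/-- `log v mod 5` is well defined on `Kˣ/Kˣ⁵`. [folklore] -/
private theorem log_valuation_cast_eq_of_mk_eq {a b : Kˣ}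
    (h : (QuotientGroup.mk a : Kˣ ⧸ (powMonoidHom 5 : Kˣ →* Kˣ).range) = QuotientGroup.mk b)
    (v : HeightOneSpectrum (𝓞 K)) :
    ((WithZero.log (v.valuation K (a : K)) : ℤ) : ZMod 5) = ((WithZero.log (v.valuation K (b : K)) : ℤ) : ZMod 5) := by
  rw [QuotientGroup.eq] at h
  obtain ⟨w, hw⟩ := h
  have hbw : (b : K) = a * (w : K) ^ 5 := by
    have := congrArg (fun z : Kˣ ↦ (z : K)) hw
    simp only [powMonoidHom_apply, Units.val_mul, Units.val_pow_eq_pow_val, Units.val_inv_eq_inv_val] at this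
    field_simp at this
    linear_combination -this
  have hva : v.valuation K (a : K) ≠ 0 := (Valuation.ne_zero_iff _).mpr a.ne_zero
  have hvw : v.valuation K (w : K) ≠ 0 := (Valuation.ne_zero_iff _).mpr w.ne_zero
  rw [hbw, map_mul, map_pow, WithZero.log_mul hva (pow_ne_zero _ hvw), WithZero.log_pow]
  rw [ZMod.intCast_eq_intCast_iff_dvd_sub]
  exact ⟨WithZero.log (v.valuation K (w : K)), by push_cast; ring⟩

omit hE [NumberField K] in
/-- `ι_*` of a `K`-rational affine point is the geometric point with the same coordinates. [folklore] -/
private theorem toGeomPoints_some {x y : K} (h : (kubertTateFive (m : K) (n : K)).toAffine.Nonsingular x y) :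
    ∃ h', toGeomPoints (kubertTateFive (m : K) (n : K)) (.some x y h) =
      .some (algebraMap K (AlgebraicClosure K) x) (algebraMap K (AlgebraicClosure K) y) h' :=
  ⟨_, Affine.Point.map_some (W' := (kubertTateFive (m : K) (n : K)).toAffine)
    (Algebra.ofId K (AlgebraicClosure K)) h⟩

section Hom

attribute [local instance 10000] Classical.propDecidable

include hψ in
/-- **The Kummer homomorphism `κ : E(K) → H¹(K, E'[ψ])`, `P ↦ [σ ↦ σQ − Q]` with `ψ Q = P`**, killing
`5E(K) = ψ(φ(E(K)))` (tree `Isogeny.exists_kummerCocycle`, `kummerClass_add`, `kummerClass_eq_of_apply_eq`).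
[cite: SilvermanAEC2009, X.§4 Prop. 4.1 and sequence (*)] -/
theorem exists_kummerHom :
    letI := ψ.kerAction
    ∃ κ : (kubertTateFive (m : K) (n : K)).toAffine.Point →+ ψ.galH1Ker,
      (∀ R, κ ((5 : ℕ) • R) = 0) ∧
      ∀ P, ∃ (c : contOneCocycles (discreteTopRep (absoluteGaloisGroup K) ψ.toAddMonoidHom.ker))
        (Q' : geomPoints (kubertTateFive' (m : K) (n : K))),
        κ P = oneCocycleClass _ c ∧
        (∀ σ, ((c.1 σ : ψ.toAddMonoidHom.ker) : geomPoints (kubertTateFive' (m : K) (n : K))) = σ • Q' - Q') ∧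
        ψ Q' = toGeomPoints _ P := by
  letI := ψ.kerAction
  choose root hroot using fun P : (kubertTateFive (m : K) (n : K)).toAffine.Point ↦
    ψ.surjective (toGeomPoints _ P)
  have hfix : ∀ P (σ : absoluteGaloisGroup K), σ • ψ (root P) = ψ (root P) := fun P σ ↦ by
    rw [hroot, smul_toGeomPoints]
  choose coc hcoc using fun P ↦ ψ.exists_kummerCocycle (hfix P)
  have hadd : ∀ P P', oneCocycleClass _ (coc (P + P')) = oneCocycleClass _ (coc P) + oneCocycleClass _ (coc P') := by
    intro P P'
    have hfix' : ∀ σ : absoluteGaloisGroup K, σ • ψ (root P + root P') = ψ (root P + root P') := fun σ ↦ by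
      rw [map_add, smul_add, hfix, hfix]
    obtain ⟨c'', hc''⟩ := ψ.exists_kummerCocycle hfix'
    rw [← ψ.kummerClass_add (coc P) (coc P') c'' (hcoc P) (hcoc P') hc'']
    exact ψ.kummerClass_eq_of_apply_eq (coc (P + P')) c'' (hcoc (P + P')) hc''
      (by rw [hroot, map_add ψ (root P) (root P'), hroot, hroot, (toGeomPoints _).map_add])
  refine ⟨AddMonoidHom.mk' (fun P ↦ oneCocycleClass _ (coc P)) hadd, fun R ↦ ?_,
    fun P ↦ ⟨coc P, root P, rfl, hcoc P, hroot P⟩⟩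
  have hQ : ψ (fiveIsogeny (m : K) (n : K) (toGeomPoints _ R)) = toGeomPoints _ ((5 : ℕ) • R) := by
    rw [hψ, (toGeomPoints _).map_nsmul, natCast_zsmul]
  have hfixφ : ∀ σ : absoluteGaloisGroup K, σ • ψ (fiveIsogeny (m : K) (n : K) (toGeomPoints _ R)) =
      ψ (fiveIsogeny (m : K) (n : K) (toGeomPoints _ R)) := fun σ ↦ by rw [hQ, smul_toGeomPoints]
  obtain ⟨c', hc'⟩ := ψ.exists_kummerCocycle hfixφ
  change oneCocycleClass _ (coc ((5 : ℕ) • R)) = 0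
  rw [ψ.kummerClass_eq_of_apply_eq (coc _) c' (hcoc _) hc' (by rw [hroot, hQ]), ψ.kummerClass_eq_zero_iff c' hc']
  exact ⟨0, AddSubgroup.zero_mem _, fun σ ↦ by rw [sub_zero, ← Isogeny.map_smul, smul_toGeomPoints]⟩

include hψ hP₁ h25 in
/-- **The valuation homomorphism `Φ : E(K) → (ℤ/5)^k`** at finite places `v₀, …, v_{k−1}` of `K`: `Φ(P)_j` is
`log v_j` mod `5` of a representative in `Kˣ` of the Kummer invariant of `κ(P)`; `Φ(5R) = 0`, and for `K`-rational affine
points `P = (x, y)`, `P' = (x', y')` off `T`, **`Φ(P) − Φ(P') = (log v_j f_T(x,y) − log v_j f_T(x',y'))_j`** (the Kummer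
invariant is the descent value `f_T(P)/f_T(5P₁)` modulo fifth powers).
[cite: SilvermanAEC2009, Exercise 10.1(c) and the proof of Thm. X.1.1(c)] [cite: Fisher2001FiveSevenDescent, §1] -/
theorem exists_valHom {k : ℕ} (pl : Fin k → HeightOneSpectrum (𝓞 K)) :
    ∃ Φ : (kubertTateFive (m : K) (n : K)).toAffine.Point →+ (Fin k → ZMod 5),
      (∀ R, Φ ((5 : ℕ) • R) = 0) ∧
      ∀ (x y : K) (h : (kubertTateFive (m : K) (n : K)).toAffine.Nonsingular x y) (_ : ¬ (x = 0 ∧ y = 0))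
        (x' y' : K) (h' : (kubertTateFive (m : K) (n : K)).toAffine.Nonsingular x' y') (_ : ¬ (x' = 0 ∧ y' = 0)),
        Φ (.some x y h) - Φ (.some x' y' h') = fun j : Fin k ↦
          ((WithZero.log ((pl j).valuation K (x * y - n * x ^ 2 + (n : K) ^ 2 * y)) -
            WithZero.log ((pl j).valuation K (x' * y' - n * x' ^ 2 + (n : K) ^ 2 * y')) : ℤ) : ZMod 5) := by
  letI := ψ.kerAction
  set T₀ := Tbar (m : K) (n : K) with hT₀
  have hT : ((5 : ℕ) : ℤ) • T₀ = 0 := five_zsmul_Tbar (m : K) (n : K)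
  have hTfix : ∀ σ : absoluteGaloisGroup K, σ • T₀ = T₀ := smul_Tbar (m : K) (n : K)
  have hker : (fiveIsogeny (m : K) (n : K)).toAddMonoidHom.ker = AddSubgroup.zmultiples T₀ :=
    ker_fiveIsogeny_eq_zmultiples (m : K) (n : K)
  obtain ⟨κ, hκ5, hκ⟩ := exists_kummerHom m n ψ hψ
  set Κ := kummerInvariant (fiveIsogeny (m : K) (n : K)) ψ hψ T₀ hT hTfix hker with hΚ
  have hrep : ∀ z : Additive (Kˣ ⧸ (powMonoidHom 5 : Kˣ →* Kˣ).range), ∃ a : Kˣ,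
      z = Additive.ofMul (QuotientGroup.mk a) := fun z ↦ by
    obtain ⟨a, ha⟩ := QuotientGroup.mk_surjective (Additive.toMul z)
    exact ⟨a, by rw [ha]; rfl⟩
  choose rep hrep using hrep
  have hΦadd : ∀ P P', (fun j : Fin k ↦ ((WithZero.log ((pl j).valuation K (rep (Κ (κ (P + P'))) : K)) : ℤ) : ZMod 5)) =
      (fun j : Fin k ↦ ((WithZero.log ((pl j).valuation K (rep (Κ (κ P)) : K)) : ℤ) : ZMod 5)) +
      (fun j : Fin k ↦ ((WithZero.log ((pl j).valuation K (rep (Κ (κ P')) : K)) : ℤ) : ZMod 5)) := by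
    intro P P'
    have hmk : (QuotientGroup.mk (rep (Κ (κ (P + P')))) : Kˣ ⧸ (powMonoidHom 5 : Kˣ →* Kˣ).range) =
        QuotientGroup.mk (rep (Κ (κ P)) * rep (Κ (κ P'))) := by
      apply Additive.ofMul.injective
      rw [QuotientGroup.mk_mul, ofMul_mul, ← hrep, ← hrep, ← hrep, map_add, map_add]
    ext j
    have hva : (pl j).valuation K (rep (Κ (κ P)) : K) ≠ 0 := (Valuation.ne_zero_iff _).mpr (rep _).ne_zero
    have hvb : (pl j).valuation K (rep (Κ (κ P')) : K) ≠ 0 := (Valuation.ne_zero_iff _).mpr (rep _).ne_zero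
    rw [Pi.add_apply, log_valuation_cast_eq_of_mk_eq hmk (pl j), Units.val_mul, map_mul,
      WithZero.log_mul hva hvb, Int.cast_add]
  refine ⟨AddMonoidHom.mk' (fun P ↦ fun j : Fin k ↦
      ((WithZero.log ((pl j).valuation K (rep (Κ (κ P)) : K)) : ℤ) : ZMod 5)) hΦadd, fun R ↦ ?_,
      fun x y h hxy x' y' h' hxy' ↦ ?_⟩
  · have hmk : (QuotientGroup.mk (rep (Κ (κ ((5 : ℕ) • R)))) : Kˣ ⧸ (powMonoidHom 5 : Kˣ →* Kˣ).range) =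
        QuotientGroup.mk 1 := by
      apply Additive.ofMul.injective
      rw [← hrep, hκ5, map_zero, QuotientGroup.mk_one, ofMul_one]
    ext j
    change ((WithZero.log ((pl j).valuation K (rep (Κ (κ ((5 : ℕ) • R))) : K)) : ℤ) : ZMod 5) = 0
    rw [log_valuation_cast_eq_of_mk_eq hmk (pl j), Units.val_one, map_one, WithZero.log_one, Int.cast_zero]
  · -- the value formula, via the descent identity `a · u⁵ · f_T(5P₁) = f_T(P)`
    obtain ⟨x₀, y₀, h₀', e₅, hT₅, he₀⟩ := exists_five_zsmul_eq m n P₁ hP₁ h25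
    have hQ₀0 : ((5 : ℕ) : ℤ) • P₁ ≠ 0 := by rw [e₅]; exact Affine.Point.some_ne_zero _
    have hQ₀T : ((5 : ℕ) : ℤ) • P₁ ≠ T₀ := by
      rw [e₅, hT₀, Tbar_eq]
      intro hh
      have hh' := Affine.Point.some.inj hh
      exact hT₅ ⟨by simpa using hh'.1, by simpa using hh'.2⟩
    have ha₀ : (kubertTateFive (m : K) (n : K)).HasValueAt (kummerFn (m : K) (n : K)) (((5 : ℕ) : ℤ) • P₁)
        (algebraMap K (AlgebraicClosure K) (x₀ * y₀ - n * x₀ ^ 2 + (n : K) ^ 2 * y₀)) := by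
      rw [e₅]
      refine (hasValueAt_kummerFn (m : K) (n : K) h₀').congr rfl ?_
      simp only [map_sub, map_add, map_mul, map_pow, map_intCast]
    have hF₀ := kummerValue_ne_zero m n he₀ hT₅
    have key : ∀ (x y : K) (h : (kubertTateFive (m : K) (n : K)).toAffine.Nonsingular x y), ¬ (x = 0 ∧ y = 0) →
        ∀ v : HeightOneSpectrum (𝓞 K), ((WithZero.log (v.valuation K (rep (Κ (κ (.some x y h))) : K)) : ℤ) : ZMod 5) =
          ((WithZero.log (v.valuation K (x * y - n * x ^ 2 + (n : K) ^ 2 * y)) -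
            WithZero.log (v.valuation K (x₀ * y₀ - n * x₀ ^ 2 + (n : K) ^ 2 * y₀)) : ℤ) : ZMod 5) := by
      intro x y h hxy v
      obtain ⟨c, Q', hκP, hc, hψQ'⟩ := hκ (.some x y h)
      obtain ⟨h₁, e₁⟩ := toGeomPoints_some m n h
      have hP0 : ψ Q' ≠ 0 := by rw [hψQ', e₁]; exact Affine.Point.some_ne_zero _
      have hPT : ψ Q' ≠ T₀ := by
        rw [hψQ', e₁, hT₀, Tbar_eq]
        intro hh
        have hh' := Affine.Point.some.inj hh
        exact hxy ⟨by simpa using hh'.1, by simpa using hh'.2⟩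
      have hb : (kubertTateFive (m : K) (n : K)).HasValueAt (kummerFn (m : K) (n : K)) (ψ Q')
          (algebraMap K (AlgebraicClosure K) (x * y - n * x ^ 2 + (n : K) ^ 2 * y)) := by
        rw [hψQ', e₁]
        refine (hasValueAt_kummerFn (m : K) (n : K) h₁).congr rfl ?_
        simp only [map_sub, map_add, map_mul, map_pow, map_intCast]
      have hF := kummerValue_ne_zero m n ((equation_iff_base m n x y).mp h.left) hxy
      obtain ⟨α, a, hαp, hcα⟩ := exists_root_of_cocycle (fiveIsogeny (m : K) (n : K)) ψ hψ T₀ hT hTfix hker c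
      have hinv := kummerInvariant_oneCocycleClass_eq_of_root (fiveIsogeny (m : K) (n : K)) ψ hψ T₀ hT hTfix hker
        c hαp hcα
      have hmk : (QuotientGroup.mk (rep (Κ (κ (.some x y h)))) : Kˣ ⧸ (powMonoidHom 5 : Kˣ →* Kˣ).range) =
          QuotientGroup.mk a := by
        apply Additive.ofMul.injective
        rw [← hrep, hκP, hΚ, hinv]
      rw [log_valuation_cast_eq_of_mk_eq hmk v]
      obtain ⟨u, hu0, hu⟩ := exists_mul_pow_eq_value_of_coboundary (fiveIsogeny (m : K) (n : K)) ψ hψ T₀ hT hTfix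
        hker (kummerFn_ne_zero (m : K) (n : K)) (ord_kummerFn (m : K) (n : K)) c hc hP0 hPT hb hQ₀0 hQ₀T hP₁ ha₀ hαp hcα
      rw [← map_mul] at hu
      have hu' := (algebraMap K (AlgebraicClosure K)).injective hu
      have hva : v.valuation K (a : K) ≠ 0 := (Valuation.ne_zero_iff _).mpr a.ne_zero
      have hvu : v.valuation K u ≠ 0 := (Valuation.ne_zero_iff _).mpr hu0
      have hvF₀ : v.valuation K (x₀ * y₀ - n * x₀ ^ 2 + (n : K) ^ 2 * y₀) ≠ 0 := (Valuation.ne_zero_iff _).mpr hF₀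
      have hv : WithZero.log (v.valuation K ((a : K) * u ^ 5 * (x₀ * y₀ - n * x₀ ^ 2 + (n : K) ^ 2 * y₀))) =
          WithZero.log (v.valuation K (x * y - n * x ^ 2 + (n : K) ^ 2 * y)) := by rw [hu']
      rw [map_mul, map_mul, map_pow, WithZero.log_mul (mul_ne_zero hva (pow_ne_zero _ hvu)) hvF₀,
        WithZero.log_mul hva (pow_ne_zero _ hvu), WithZero.log_pow] at hv
      rw [ZMod.intCast_eq_intCast_iff_dvd_sub]
      exact ⟨WithZero.log (v.valuation K u), by rw [nsmul_eq_mul] at hv; push_cast at hv ⊢; linarith⟩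
    ext j
    change ((WithZero.log ((pl j).valuation K (rep (Κ (κ (.some x y h))) : K)) : ℤ) : ZMod 5) -
        ((WithZero.log ((pl j).valuation K (rep (Κ (κ (.some x' y' h'))) : K)) : ℤ) : ZMod 5) = _
    rw [key x y h hxy (pl j), key x' y' h' hxy' (pl j)]
    push_cast
    ring

/-! ## §3 The box-filling criterion at `k` places -/

/-- `E(K)/5E(K)` is finite (Mordell–Weil; `#(E(K)/5E(K)) = 5^rank · #E(K)[5]`). [cite: SilvermanAEC2009, Thm. VIII.6.7] -/
theorem finite_quotient_five :
    Finite ((kubertTateFive (m : K) (n : K)).toAffine.Point ⧸ (nsmulAddMonoidHom (5 : ℕ) :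
      (kubertTateFive (m : K) (n : K)).toAffine.Point →+ (kubertTateFive (m : K) (n : K)).toAffine.Point).range) := by
  haveI : Module.Finite ℤ (kubertTateFive (m : K) (n : K)).toAffine.Point := by
    convert module_finite_point_holds (kubertTateFive (m : K) (n : K))
  haveI : Finite (AddSubgroup.torsionBy (kubertTateFive (m : K) (n : K)).toAffine.Point ((5 : ℕ) : ℤ)) :=
    Literature.NumberTheory.EllipticCurves.finite_torsionBy_of_injective
      (toGeomPoints (kubertTateFive (m : K) (n : K))) (toGeomPoints_injective _) _
      (WeierstrassCurve.finite_torsionBy_of_isAlgClosed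
        (V := (kubertTateFive (m : K) (n : K)).baseChange (AlgebraicClosure K)) (by norm_num))
  have hcard := natCard_quotient_nsmulRange_eq (kubertTateFive (m : K) (n : K)).toAffine.Point 5
  apply Nat.finite_of_card_ne_zero
  rw [hcard]
  exact mul_ne_zero (pow_ne_zero _ (by norm_num)) Nat.card_pos.ne'

include hP₁ h25 in
/-- **The box-filling criterion, matrix form, over a number field.** Take finite places `v₀, …, v_{k−1}` of `K`,
`k` affine `K`-points `P_i ≠ T` and a base point `P' ≠ T`, and let `M_{ij} = log v_j f_T(P_i) − log v_j f_T(P') mod 5`.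
If `c ↦ cM` is onto `(ℤ/5)^k` (e.g. `M` has a left inverse mod `5`) then **`5 ^ k ≤ #(E(K)/5E(K))`**: the valuation
homomorphism `Φ` of `exists_valHom` factors through `E(K)/5E(K)` and is onto. [cite: SilvermanAEC2009, Thm. X.1.1 and Exercise 10.1(c)]
[cite: Fisher2001FiveSevenDescent, §2] -/
theorem pow_le_natCard_quotient_of_matrix {k : ℕ} (pl : Fin k → HeightOneSpectrum (𝓞 K))
    (x y : Fin k → K) (hns : ∀ i, (kubertTateFive (m : K) (n : K)).toAffine.Nonsingular (x i) (y i))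
    (hxy : ∀ i, ¬ (x i = 0 ∧ y i = 0))
    (x' y' : K) (hns' : (kubertTateFive (m : K) (n : K)).toAffine.Nonsingular x' y') (hxy' : ¬ (x' = 0 ∧ y' = 0))
    (hM : ∀ e : Fin k → ZMod 5, ∃ c : Fin k → ZMod 5, Matrix.vecMul c (Matrix.of (fun i j : Fin k ↦
      ((WithZero.log ((pl j).valuation K (x i * y i - n * x i ^ 2 + (n : K) ^ 2 * y i)) -
        WithZero.log ((pl j).valuation K (x' * y' - n * x' ^ 2 + (n : K) ^ 2 * y')) : ℤ) : ZMod 5))) = e) :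
    5 ^ k ≤ Nat.card ((kubertTateFive (m : K) (n : K)).toAffine.Point ⧸ (nsmulAddMonoidHom (5 : ℕ) :
        (kubertTateFive (m : K) (n : K)).toAffine.Point →+ (kubertTateFive (m : K) (n : K)).toAffine.Point).range) := by
  obtain ⟨ψ, hψ⟩ := exists_dual (K := K) m n
  obtain ⟨Φ, hΦ5, hΦ⟩ := exists_valHom m n ψ hψ P₁ hP₁ h25 pl
  set N := (nsmulAddMonoidHom (5 : ℕ) :
    (kubertTateFive (m : K) (n : K)).toAffine.Point →+ (kubertTateFive (m : K) (n : K)).toAffine.Point).range with hN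
  have hNker : N ≤ Φ.ker := by
    rintro _ ⟨R, rfl⟩
    rw [AddMonoidHom.mem_ker, nsmulAddMonoidHom_apply, hΦ5]
  set Φbar := QuotientAddGroup.lift N Φ hNker with hΦbar
  have hsurj : Function.Surjective Φbar := by
    intro e
    obtain ⟨c, hc⟩ := hM e
    refine ⟨QuotientAddGroup.mk (∑ i, (c i).val • (Affine.Point.some (x i) (y i) (hns i) - .some x' y' hns')), ?_⟩
    rw [hΦbar, QuotientAddGroup.lift_mk, map_sum, ← hc]
    funext j
    rw [Finset.sum_apply, Matrix.vecMul, dotProduct]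
    refine Finset.sum_congr rfl fun i _ ↦ ?_
    rw [map_nsmul, map_sub, hΦ (x i) (y i) (hns i) (hxy i) x' y' hns' hxy', Pi.smul_apply, Matrix.of_apply,
      nsmul_eq_mul, ZMod.natCast_zmod_val]
  haveI := finite_quotient_five (K := K) m n
  have hle := Nat.card_le_card_of_surjective Φbar hsurj
  have hfun : Nat.card (Fin k → ZMod 5) = 5 ^ k := by
    rw [Nat.card_fun, Nat.card_eq_fintype_card (α := ZMod 5), ZMod.card, Nat.card_eq_fintype_card, Fintype.card_fin]
  rw [hfun] at hle
  exact hle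

end Hom

end KubertTateMuDescentNF

end Literature.NumberTheory.EllipticCurves

end
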